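import Mathlib
import HarnessLib
import Summits.HubbardSuperconductivity.HubbardSuperconductivity.Theorems.KLProgrammeKLRegimeTwoVolumeLipTowerDefs
import Summits.HubbardSuperconductivity.HubbardSuperconductivity.Theorems.KLProgrammeKLRegimeTwoVolumeTowerBaseTransfer
import Summits.HubbardSuperconductivity.HubbardSuperconductivity.Theorems.KLProgrammeKLRegimeEngineScaleZeroGridTransfer

/-!
# Route `KLProgramme` — crux K3 ENGINE (stmt-HubbardSuperconductivity-20437), stub (e) proof-input «(e)-D-ROWS», G-4 (objects): THE BASE OF THE TWO-VOLUME
# LIPSCHITZ TOWER — the scale-0 analysed action as a GRID TRANSFER of the UV grid action, the grid block embedding / glue, and the periodisation of the transfer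
# (seat hubbard-kl-k3c4-p1 g24; definition lane; `--supports` 20437; DROWS-SCOPE-g24 v8 §10.4)

The base object of the two-volume Lipschitz tower (`…TwoVolumeLipBaseRemeasure`: T3-Lip's `db`-base) is
`BD_base = A_{bL} − klGlue (A_L)`, `A_V := sectorPreimage β F_0(V) 𝒱⁽⁰⁾(V)`, `𝒱⁽⁰⁾(V) = klEffectiveAction V M β U μ K klE0 0`.  By E1's grid identity
(`EngineV8.klEffectiveAction_zero_eq_map_hubbardGridSub`) `𝒱⁽⁰⁾(V) = map (toLin′ S_N) G_V` with the UV GRID ACTION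
`G_V = effAction (S_Nᵀ C^K_{>e₀} S_N) (V_N + 𝒩_{K,N})` on the grid legs `GridLeg (GridPoint V N)`, `N = klGridN M = 4M`, and by
`…LipTowerDefs.sectorPreimage_eq_map_smul_sectorAnalysis`, `A_V = map (toLin′ T_V) G_V` with the BASE TRANSFER `T_V = (ε • E_V(F_0)) · S_N`.  So `BD_base` is the element of
k3c5-p2's deep-pin transfer door `…TwoVolumeSubstitutionGluingDeepPin.sum_norm_kernel_map_sub_glue_map_le_of_defect` with INPUT block structure route A's
`…TwoVolumeTowerBaseDefs.klGridBlockEquiv L b M` (grid legs) and OUTPUT block structure `klBlockEquiv L b M (sectorCount 0)`, whose defect is the two-volume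
difference `G_{bL} − klGridGlue G_L` of the UV grid actions — route A's base datum (M4a `…TwoVolumeScaleZeroTopFrame.hubbardGrid_sum_norm_kernel_twoVolume_stepZero_le`,
at a COMMON frame).  This file supplies the objects and the two structural facts the door needs:

* `klGridBlockEmb L b M β′` (the `LinearMap.pi` block embedding over `klGridBlockEquiv`, `klGridBlockEmb_apply` = the door's `hFe₁`), `klGridGlue L b M W := Σ_β′ map (klGridBlockEmb β′) W`;
* `klGridActionZero V M β U μ K` (the UV grid action at cutoff `klE0`), `klLipBaseTransfer V M β μ K := (ε • E_V(F_0)) · S_N`;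
* `scaleZeroAnalysed_eq_map_klLipBaseTransfer` — `A_V = map (toLin′ T_V) G_V`; `klLipBaseDiff_eq_transfer_form` — `BD_base` in the door's form;
* `klLipBaseTransfer_periodise` — the door's `hP`: `Σ_{res Y″ = Y} T_{bL} X′ Y″ = T_L (res X′) Y` (route A's `gridOverlap_periodise_leg` with the sampled family
  `klAnisoFamily_eq_sampled`, exactly as the alive block of `…TowerBaseTransfer.klBaseTransfer_periodise`).

Definitions + identities only; nothing asserts the (D) rows, stub (e), VL, K3 or superconductivity.
References: BGM 2006 §2.7 (2.70)–(2.71), §2.9 [cite: BenfattoGiulianiMastropietro2006].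
-/

noncomputable section

namespace Summit.HubbardSuperconductivity.HubbardSuperconductivity.Theorems.TwoVolumeLip

set_option linter.dupNamespace false -- summit = problem name (single-conjunct summit), D-0017

open Finset Literature.MathematicalPhysics.QuantumLattice GrassmannAlgebra Literature.Probability.LatticeModels
open Literature.MathematicalPhysics.QuantumLattice.FermiRG
open Summit.HubbardSuperconductivity.HubbardSuperconductivity.Theorems.KLRegimeSplit
open Summit.HubbardSuperconductivity.HubbardSuperconductivity.Theorems.KLProgrammeLegKernels
open Summit.HubbardSuperconductivity.HubbardSuperconductivity.Theorems.DispersionFlow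
open Summit.HubbardSuperconductivity.HubbardSuperconductivity.Theorems.EngineV8
open Summit.HubbardSuperconductivity.HubbardSuperconductivity.Theorems.TwoVolumeSource
open Summit.HubbardSuperconductivity.HubbardSuperconductivity.Theorems.TwoVolumeDefect
open Summit.HubbardSuperconductivity.HubbardSuperconductivity.Theorems.TwoPointAssembly

/-! ## §1 The grid block embedding and glue -/

section Grid

variable (L b M : ℕ) [NeZero L] [NeZero (b * L)]

/-- **`klGridBlockEmb L b M β′`** — the embedding of block `β′` of the canonical grid block structure `klGridBlockEquiv L b M`:
`(klGridBlockEmb … β′ v) X′ = [blk X′ = β′] · v (res X′)`. [folklore] -/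
def klGridBlockEmb (β' : Fin 2 → Fin b) :
    (GridLeg (GridPoint L (klGridN M)) → ℂ) →ₗ[ℂ] (GridLeg (GridPoint (b * L) (klGridN M)) → ℂ) :=
  LinearMap.pi fun X' : GridLeg (GridPoint (b * L) (klGridN M)) =>
    if (klGridBlockEquiv L b M X').1 = β' then
      (LinearMap.proj (klGridBlockEquiv L b M X').2 : (GridLeg (GridPoint L (klGridN M)) → ℂ) →ₗ[ℂ] ℂ) else 0

/-- **`klGridGlue L b M W`** — the glued coarse grid element on the fine grid legs: `Σ_β′ map (klGridBlockEmb … β′) W`. [folklore] -/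
def klGridGlue (W : GrassmannAlgebra ℂ (GridLeg (GridPoint L (klGridN M)))) : GrassmannAlgebra ℂ (GridLeg (GridPoint (b * L) (klGridN M))) :=
  ∑ β' : Fin 2 → Fin b, ExteriorAlgebra.map (klGridBlockEmb L b M β') W

variable {L b M}

/-- **The defining property of the grid block embedding** (the door's `hFe₁`). -/
theorem klGridBlockEmb_apply (β' : Fin 2 → Fin b) (v : GridLeg (GridPoint L (klGridN M)) → ℂ) (X' : GridLeg (GridPoint (b * L) (klGridN M))) :
    klGridBlockEmb L b M β' v X' = if (klGridBlockEquiv L b M X').1 = β' then v (klGridBlockEquiv L b M X').2 else 0 :=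
  blockEmb_pi_apply ℂ (klGridBlockEquiv L b M) β' v X'

/-- Unfolding `klGridGlue`. -/
theorem klGridGlue_def (W : GrassmannAlgebra ℂ (GridLeg (GridPoint L (klGridN M)))) :
    klGridGlue L b M W = ∑ β' : Fin 2 → Fin b, ExteriorAlgebra.map (klGridBlockEmb L b M β') W := rfl

end Grid

/-! ## §2 The UV grid action and the base transfer -/

section OneVolume

variable (V M : ℕ) [NeZero V]

/-- **`klGridActionZero V M β U μ K`** — the UV GRID ACTION at the top cutoff `klE0`: `effAction (S_Nᵀ C^K_{>klE0} S_N) (V_N + 𝒩_{K,N})` on the grid legs,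
`N = klGridN M` (`EngineV8.klEffectiveAction_zero_eq_map_hubbardGridSub`: `𝒱⁽⁰⁾ = map (toLin′ S_N) (klGridActionZero …)`). [cite: BenfattoGiulianiMastropietro2006, §2.9] -/
def klGridActionZero (β U μ : ℝ) (K : TrigPolyC4v) : GrassmannAlgebra ℂ (GridLeg (GridPoint V (klGridN M))) :=
  effAction ℂ ((hubbardGridSub V M β (klGridN M)).transpose * hubbardCovAboveCT V M β μ 0 K klE0 * hubbardGridSub V M β (klGridN M))
    (hubbardGridInteraction V (klGridN M) β U + hubbardGridCounterQuadratic V (klGridN M) β K)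

/-- **`klLipBaseTransfer V M β μ K`** — the BASE TRANSFER from the grid legs to the scale-0 sector labels: `(ε • E_V(F_0)) · S_N`. [cite: BenfattoGiulianiMastropietro2006, §2.7 (2.71)] -/
def klLipBaseTransfer (β μ : ℝ) (K : TrigPolyC4v) :
    Matrix (SpaceTimeIdx V M × SectorLeg (sectorCount 0)) (GridLeg (GridPoint V (klGridN M))) ℂ :=
  ((((imagTimeWeight β M : ℝ) : ℂ)) • sectorAnalysisMatrix V M β (klAnisoFamily V M β μ K klE0 0)) * hubbardGridSub V M β (klGridN M)

variable {V M}

/-- Unfolding `klGridActionZero`. -/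
theorem klGridActionZero_def (β U μ : ℝ) (K : TrigPolyC4v) :
    klGridActionZero V M β U μ K =
      effAction ℂ ((hubbardGridSub V M β (klGridN M)).transpose * hubbardCovAboveCT V M β μ 0 K klE0 * hubbardGridSub V M β (klGridN M))
        (hubbardGridInteraction V (klGridN M) β U + hubbardGridCounterQuadratic V (klGridN M) β K) := rfl

/-- Unfolding `klLipBaseTransfer`. -/
theorem klLipBaseTransfer_def (β μ : ℝ) (K : TrigPolyC4v) :
    klLipBaseTransfer V M β μ K =
      ((((imagTimeWeight β M : ℝ) : ℂ)) • sectorAnalysisMatrix V M β (klAnisoFamily V M β μ K klE0 0)) * hubbardGridSub V M β (klGridN M) := rfl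

variable [NeZero M]

/-- **The scale-0 analysed action is the base transfer of the UV grid action**: `sectorPreimage β F_0 𝒱⁽⁰⁾ = map (toLin′ (klLipBaseTransfer …)) (klGridActionZero …)`. -/
theorem scaleZeroAnalysed_eq_map_klLipBaseTransfer {β : ℝ} (hβ : β ≠ 0) (U μ : ℝ) (K : TrigPolyC4v) :
    sectorPreimage β (klAnisoFamily V M β μ K klE0 0) (klEffectiveAction V M β U μ K klE0 0) =
      ExteriorAlgebra.map (Matrix.toLin' (klLipBaseTransfer V M β μ K)) (klGridActionZero V M β U μ K) := by
  rw [sectorPreimage_eq_map_smul_sectorAnalysis, klEffectiveAction_zero_eq_map_hubbardGridSub hβ U μ K klE0, map_map_eq_map_comp,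
    ← Matrix.toLin'_mul]
  rfl

end OneVolume

/-! ## §3 Two volumes: the base difference in the door's form, and the periodisation of the base transfer -/

section TwoVolumes

variable {L b M : ℕ} [NeZero L] [NeZero (b * L)] [NeZero M]

/-- **`BD_base` in the transfer door's form**: `A_{bL} − klGlue A_L = map (toLin′ T_{bL}) G_{bL} − klGlue (map (toLin′ T_L) G_L)`. -/
theorem klLipBaseDiff_eq_transfer_form {β : ℝ} (hβ : β ≠ 0) (U μ : ℝ) (K : TrigPolyC4v) :
    sectorPreimage β (klAnisoFamily (b * L) M β μ K klE0 0) (klEffectiveAction (b * L) M β U μ K klE0 0) -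
        klGlue L b M (sectorCount 0) (sectorPreimage β (klAnisoFamily L M β μ K klE0 0) (klEffectiveAction L M β U μ K klE0 0)) =
      ExteriorAlgebra.map (Matrix.toLin' (klLipBaseTransfer (b * L) M β μ K)) (klGridActionZero (b * L) M β U μ K) -
        klGlue L b M (sectorCount 0) (ExteriorAlgebra.map (Matrix.toLin' (klLipBaseTransfer L M β μ K)) (klGridActionZero L M β U μ K)) := by
  rw [scaleZeroAnalysed_eq_map_klLipBaseTransfer hβ, scaleZeroAnalysed_eq_map_klLipBaseTransfer hβ]

/-- **(P) for the base transfer** — the door's `hP` with input structure `klGridBlockEquiv` and output structure `klBlockEquiv … (sectorCount 0)`: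
`Σ_{(klGridBlockEquiv Y″).2 = Y} T_{bL} X′ Y″ = T_L (klBlockEquiv … X′).2 Y` (`β ≠ 0`; `gridOverlap_periodise_leg` with the sampled scale-0 family). -/
theorem klLipBaseTransfer_periodise {β : ℝ} (hβ : β ≠ 0) (μ : ℝ) (K : TrigPolyC4v)
    (X' : SpaceTimeIdx (b * L) M × SectorLeg (sectorCount 0)) (Y : GridLeg (GridPoint L (klGridN M))) :
    ∑ Y'' ∈ univ.filter (fun Y'' : GridLeg (GridPoint (b * L) (klGridN M)) => (klGridBlockEquiv L b M Y'').2 = Y),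
        klLipBaseTransfer (b * L) M β μ K X' Y'' = klLipBaseTransfer L M β μ K (klBlockEquiv L b M (sectorCount 0) X').2 Y := by
  classical
  simp only [klLipBaseTransfer, Matrix.smul_mul, Matrix.smul_apply, smul_eq_mul, ← mul_sum]
  rw [gridOverlap_periodise_leg (rfl : b * L = b * L) hβ
    (fun (ω' : Fin (sectorCount 0)) (i' : MatsubaraIdx M) (p : Fin 2 → ℝ) =>
      (((gnScaleCutoff 4 klE0 (-((0 : ℕ) : ℤ)) (Real.sqrt (matsubaraFreq β M i' ^ 2 + (-2 * ∑ j, Real.cos (p j) - μ - K.eval p) ^ 2)) *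
          sectorWeightCirc 0 ω' (polarAngle (fun j => toIocMod Real.two_pi_pos (-Real.pi) (p j))) : ℝ) : ℂ)))
    (klAnisoFamily L M β μ K klE0 0) (klAnisoFamily (b * L) M β μ K klE0 0)
    (fun ω i q => klAnisoFamily_eq_sampled β μ K klE0 0 ω i q) (fun ω i q => klAnisoFamily_eq_sampled β μ K klE0 0 ω i q)
    (klGridBlockEquiv L b M) (klGridBlockEquiv_snd L b M) X' Y, klBlockEquiv_snd L b M]

end TwoVolumes

end Summit.HubbardSuperconductivity.HubbardSuperconductivity.Theorems.TwoVolumeLip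

end
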